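import Literature.NumberTheory.Sieve.FriedlanderIwaniecPrimesJacobiTwistedLemmas
import Literature.NumberTheory.Sieve.VaughanMeanValueDecomposition
import HarnessLib

/-!
# Friedlander–Iwaniec, *The polynomial `X² + Y⁴` captures its primes*, §12: the pairs with equal
# denominators in the smoothed form (12.6)

[FI, §12, pp. 50–51 of arXiv:math/9811185 = Ann. of Math. (2) 148 (1998), 945–1040].  A piece of
bookkeeping that the printed proof of Proposition 12.1 leaves to the reader: in (12.8) "we reduce the
variables `r₁, r₂` by the common divisor `c = (r₁, r₂)`" and then apply Proposition 11.1* on the box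
`R/c < r ≤ 2R/c`; for the pairs with `r₁ = r₂` one has `c = r₁ > R`, that box is degenerate, and
these pairs have to be bounded directly.  `norm_sum_eqDenom_le` PROVES: with `(d, r) = 1` forced by
the symbol `(d/r²)`, the congruence `d ∣ r(s₂ − s₁)` becomes `d ∣ s₂ − s₁`, and counting divisors
(`∑_{n ≤ S} τ(n) ≤ S(1 + log S)`) bounds the `r₁ = r₂` part of
`∑_d f(d) ∑∑_{d ∣ r₁s₂−r₂s₁} α_{r₁s₁}ᾱ_{r₂s₂}(d/(r₁r₂)) g` by `(3D + 2S(1 + log S))‖α‖²` — negligible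
against (12.4).  No definitions, no named facts (HOME/parity-ideate-lit/FI98-Prop121-MAP.md, step 8).

## References

* J. Friedlander, H. Iwaniec, *The polynomial `X² + Y⁴` captures its primes*, Ann. of Math. (2) 148
  (1998), 945–1040, §12, (12.6)–(12.9). [FriedlanderIwaniecAnnals1998]

## Tree / Mathlib

Tree: `Vaughan.sum_card_divisors_le` (`∑_{n ≤ Z} τ(n) ≤ Z(1 + log Z)`, `VaughanMeanValueDecomposition`).
Mathlib: `jacobiSym.eq_zero_iff`, `jacobiSym.trichotomy`, `Finset.sum_image`.
-/

noncomputable section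

open Finset Real Complex
open scoped NumberTheorySymbols ArithmeticFunction.sigma Nat ComplexConjugate

namespace Literature.NumberTheory.Sieve.FriedlanderIwaniecPrimes

/-! ### The pairs with equal denominators `r₁ = r₂` -/

/-- The number of `d ∈ 𝒟` dividing a nonzero integer `n` is at most `τ(|n|)`. [folklore] -/
private theorem card_filter_dvd_le_card_divisors_natAbs (𝒟 : Finset ℕ) {n : ℤ} (hn : n ≠ 0) :
    #(𝒟.filter fun d : ℕ => (d : ℤ) ∣ n) ≤ #(n.natAbs.divisors) := by
  refine card_le_card_of_injOn id (fun d hd => ?_) (Set.injOn_id _)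
  rw [mem_coe, mem_filter] at hd
  rw [mem_coe, Nat.mem_divisors]
  exact ⟨Int.natCast_dvd.mp hd.2, Int.natAbs_ne_zero.mpr hn⟩

/-- `∑_{s₂ ∈ (S, 2S], s₂ ≠ s₁} τ(|s₂ − s₁|) ≤ 2 S (1 + log S)` for `s₁ ∈ (S, 2S]`. [folklore] -/
private theorem sum_card_divisors_sub_le {S s₁ : ℕ} (hs₁ : s₁ ∈ Ioc S (2 * S)) :
    ∑ s₂ ∈ (Ioc S (2 * S)).filter (fun s₂ => s₂ ≠ s₁),
        (#(((s₂ : ℤ) - s₁).natAbs.divisors) : ℝ) ≤ 2 * (S * (1 + Real.log S)) := by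
  have hs₁' := mem_Ioc.mp hs₁
  have hV := Literature.NumberTheory.Sieve.Vaughan.sum_card_divisors_le S
  -- split `s₂ > s₁` and `s₂ < s₁`
  have hsplit : (Ioc S (2 * S)).filter (fun s₂ => s₂ ≠ s₁) =
      (Ioc S (2 * S)).filter (fun s₂ => s₁ < s₂) ∪ (Ioc S (2 * S)).filter (fun s₂ => s₂ < s₁) := by
    ext s₂
    simp only [mem_filter, mem_union, mem_Ioc]
    omega
  have hdisj : Disjoint ((Ioc S (2 * S)).filter (fun s₂ => s₁ < s₂))
      ((Ioc S (2 * S)).filter (fun s₂ => s₂ < s₁)) := by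
    rw [disjoint_filter]
    intro s₂ _ h1 h2
    omega
  rw [hsplit, sum_union hdisj]
  have hnn : ∀ n ∈ Ioc 0 S, (0 : ℝ) ≤ #(n.divisors) := fun _ _ => Nat.cast_nonneg _
  -- `s₂ > s₁`: `n = s₂ - s₁`
  have hA : ∑ s₂ ∈ (Ioc S (2 * S)).filter (fun s₂ => s₁ < s₂),
      (#(((s₂ : ℤ) - s₁).natAbs.divisors) : ℝ) ≤ S * (1 + Real.log S) := by
    have hinj : Set.InjOn (fun s₂ : ℕ => s₂ - s₁) ((Ioc S (2 * S)).filter (fun s₂ => s₁ < s₂)) := by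
      intro a ha b hb h
      rw [mem_coe, mem_filter] at ha hb
      simp only at h
      omega
    calc ∑ s₂ ∈ (Ioc S (2 * S)).filter (fun s₂ => s₁ < s₂), (#(((s₂ : ℤ) - s₁).natAbs.divisors) : ℝ)
        = ∑ s₂ ∈ (Ioc S (2 * S)).filter (fun s₂ => s₁ < s₂), (#((s₂ - s₁).divisors) : ℝ) := by
          refine sum_congr rfl fun s₂ hs₂ => ?_
          have h := (mem_filter.mp hs₂).2
          congr 3
          rw [← Nat.cast_sub h.le]
          exact Int.natAbs_natCast _
      _ = ∑ n ∈ ((Ioc S (2 * S)).filter (fun s₂ => s₁ < s₂)).image (fun s₂ => s₂ - s₁),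
            (#(n.divisors) : ℝ) := (sum_image (f := fun n : ℕ => (#(n.divisors) : ℝ)) hinj).symm
      _ ≤ ∑ n ∈ Ioc 0 S, (#(n.divisors) : ℝ) := by
          refine sum_le_sum_of_subset_of_nonneg ?_ fun n hn _ => hnn n hn
          intro n hn
          obtain ⟨s₂, hs₂, rfl⟩ := mem_image.mp hn
          have h := mem_filter.mp hs₂
          have h' := mem_Ioc.mp h.1
          rw [mem_Ioc]
          omega
      _ ≤ S * (1 + Real.log S) := hV
  -- `s₂ < s₁`: `n = s₁ - s₂`
  have hB : ∑ s₂ ∈ (Ioc S (2 * S)).filter (fun s₂ => s₂ < s₁),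
      (#(((s₂ : ℤ) - s₁).natAbs.divisors) : ℝ) ≤ S * (1 + Real.log S) := by
    have hinj : Set.InjOn (fun s₂ : ℕ => s₁ - s₂) ((Ioc S (2 * S)).filter (fun s₂ => s₂ < s₁)) := by
      intro a ha b hb h
      rw [mem_coe, mem_filter] at ha hb
      simp only at h
      omega
    calc ∑ s₂ ∈ (Ioc S (2 * S)).filter (fun s₂ => s₂ < s₁), (#(((s₂ : ℤ) - s₁).natAbs.divisors) : ℝ)
        = ∑ s₂ ∈ (Ioc S (2 * S)).filter (fun s₂ => s₂ < s₁), (#((s₁ - s₂).divisors) : ℝ) := by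
          refine sum_congr rfl fun s₂ hs₂ => ?_
          have h := (mem_filter.mp hs₂).2
          congr 3
          rw [show ((s₂ : ℤ) - s₁) = -((s₁ - s₂ : ℕ) : ℤ) by rw [Nat.cast_sub h.le]; ring,
            Int.natAbs_neg]
          exact Int.natAbs_natCast _
      _ = ∑ n ∈ ((Ioc S (2 * S)).filter (fun s₂ => s₂ < s₁)).image (fun s₂ => s₁ - s₂),
            (#(n.divisors) : ℝ) := (sum_image (f := fun n : ℕ => (#(n.divisors) : ℝ)) hinj).symm
      _ ≤ ∑ n ∈ Ioc 0 S, (#(n.divisors) : ℝ) := by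
          refine sum_le_sum_of_subset_of_nonneg ?_ fun n hn _ => hnn n hn
          intro n hn
          obtain ⟨s₂, hs₂, rfl⟩ := mem_image.mp hn
          have h := mem_filter.mp hs₂
          have h' := mem_Ioc.mp h.1
          rw [mem_Ioc]
          omega
      _ ≤ S * (1 + Real.log S) := hV
  linarith

/-- **The pairs `r₁ = r₂` of (12.6)** [FI, §12]: for any coefficients `α`, a majorant
`0 ≤ F ≤ 1` vanishing off `(1/2, 5/2)` (FI's `f(d) = F(d/D)`), and any pair factor `G` with
`|G| ≤ 1` (FI's `g(|s₁/r₁ − s₂/r₂|)`),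
`|∑_{d ≤ N} F(d/D) ∑_r ∑∑_{s₁,s₂: d ∣ r(s₂−s₁)} α_{rs₁} ᾱ_{rs₂} (d/r²) G| ≤ (3D + 2S(1 + log S)) ‖α‖²`:
the symbol forces `(d, r) = 1`, so `d ∣ s₂ − s₁`; the terms `s₁ = s₂` give `3D‖α‖²` and the others
at most `∑∑ |α_{rs₁}|² τ(|s₂ − s₁|) ≤ 2S(1 + log S)‖α‖²`.  (On the dyadic box these are exactly the
pairs with `c = (r₁, r₂) > R`, excluded from the reduction (12.8)–(12.9).)
[cite: FriedlanderIwaniecAnnals1998, §12, (12.6)–(12.9)] -/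
theorem norm_sum_eqDenom_le {D R S N : ℕ} (α : ℕ → ℕ → ℂ) (F : ℝ → ℝ) (hF0 : ∀ w, 0 ≤ F w)
    (hF1 : ∀ w, F w ≤ 1) (hF3 : ∀ w, w ≤ 1 / 2 → F w = 0) (hF4 : ∀ w, 5 / 2 ≤ w → F w = 0)
    (G : ℕ → ℕ → ℕ → ℕ → ℂ) (hG : ∀ r₁ s₁ r₂ s₂, ‖G r₁ s₁ r₂ s₂‖ ≤ 1) :
    ‖∑ d ∈ Ioc 0 N, (F ((d : ℝ) / D) : ℂ) * ∑ r₁ ∈ Ioc R (2 * R), ∑ s₁ ∈ Ioc S (2 * S),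
        ∑ r₂ ∈ Ioc R (2 * R), ∑ s₂ ∈ Ioc S (2 * S),
        (if r₁ = r₂ ∧ (d : ℤ) ∣ (r₁ : ℤ) * s₂ - (r₂ : ℤ) * s₁ then
          α r₁ s₁ * conj (α r₂ s₂) * (J((d : ℤ) | r₁ * r₂) : ℂ) * G r₁ s₁ r₂ s₂ else 0)‖ ≤
      (3 * D + 2 * (S * (1 + Real.log S))) *
        ∑ r ∈ Ioc R (2 * R), ∑ s ∈ Ioc S (2 * S), ‖α r s‖ ^ 2 := by
  set IR := Ioc R (2 * R) with hIR
  set IS := Ioc S (2 * S) with hIS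
  set N2 : ℝ := ∑ r ∈ IR, ∑ s ∈ IS, ‖α r s‖ ^ 2 with hN2
  set 𝒟 := (Ioc 0 N).filter (fun d : ℕ => F ((d : ℝ) / D) ≠ 0) with h𝒟def
  -- `#𝒟 ≤ 3D`
  have hcard : (#𝒟 : ℝ) ≤ 3 * D := by
    rcases Nat.eq_zero_or_pos D with hDz | hDp
    · have : 𝒟 = ∅ := by
        rw [h𝒟def, filter_eq_empty_iff]
        intro d _ h
        apply h
        rw [hDz, Nat.cast_zero, div_zero]
        exact hF3 0 (by norm_num)
      rw [this, card_empty, hDz]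
      simp
    · have hD0 : (0 : ℝ) < D := by exact_mod_cast hDp
      have hsub : 𝒟 ⊆ Ioc 0 (3 * D) := by
        intro d hd
        rw [h𝒟def, mem_filter, mem_Ioc] at hd
        rw [mem_Ioc]
        refine ⟨hd.1.1, ?_⟩
        by_contra hlt
        refine hd.2 (hF4 _ ?_)
        rw [le_div_iff₀ hD0]
        have : (3 * D : ℝ) < d := by exact_mod_cast (not_le.mp hlt)
        linarith
      calc (#𝒟 : ℝ) ≤ #(Ioc 0 (3 * D)) := by exact_mod_cast card_le_card hsub
        _ = 3 * D := by rw [Nat.card_Ioc, Nat.sub_zero]; push_cast; ring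
  -- collapse `r₂ = r₁`
  have hdiag : ∀ d : ℕ, ∑ r₁ ∈ IR, ∑ s₁ ∈ IS, ∑ r₂ ∈ IR, ∑ s₂ ∈ IS,
      (if r₁ = r₂ ∧ (d : ℤ) ∣ (r₁ : ℤ) * s₂ - (r₂ : ℤ) * s₁ then
        α r₁ s₁ * conj (α r₂ s₂) * (J((d : ℤ) | r₁ * r₂) : ℂ) * G r₁ s₁ r₂ s₂ else 0) =
      ∑ r ∈ IR, ∑ s₁ ∈ IS, ∑ s₂ ∈ IS,
        (if (d : ℤ) ∣ (r : ℤ) * s₂ - (r : ℤ) * s₁ then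
          α r s₁ * conj (α r s₂) * (J((d : ℤ) | r * r) : ℂ) * G r s₁ r s₂ else 0) := by
    intro d
    refine sum_congr rfl fun r₁ hr₁ => sum_congr rfl fun s₁ _ => ?_
    rw [sum_eq_single_of_mem r₁ hr₁ (fun r₂ _ hne => sum_eq_zero fun s₂ _ =>
      if_neg fun h => hne h.1.symm)]
    refine sum_congr rfl fun s₂ _ => ?_
    simp only [true_and]
  -- termwise bound
  have hterm : ∀ d ∈ 𝒟, ∀ r ∈ IR, ∀ s₁ ∈ IS, ∀ s₂ ∈ IS,
      ‖(if (d : ℤ) ∣ (r : ℤ) * s₂ - (r : ℤ) * s₁ then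
        α r s₁ * conj (α r s₂) * (J((d : ℤ) | r * r) : ℂ) * G r s₁ r s₂ else 0)‖ ≤
      (if (d : ℤ) ∣ (s₂ : ℤ) - s₁ then ‖α r s₁‖ * ‖α r s₂‖ else 0) := by
    intro d _ r hr s₁ _ s₂ _
    have hr0 : r ≠ 0 := by have := (mem_Ioc.mp hr).1; omega
    by_cases h1 : (d : ℤ) ∣ (r : ℤ) * s₂ - (r : ℤ) * s₁
    · rw [if_pos h1]
      by_cases h2 : (d : ℤ) ∣ (s₂ : ℤ) - s₁
      · rw [if_pos h2, norm_mul, norm_mul, norm_mul, Complex.norm_conj]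
        have hJ : ‖(J((d : ℤ) | r * r) : ℂ)‖ ≤ 1 := by
          rcases jacobiSym.trichotomy (d : ℤ) (r * r) with h | h | h <;> simp [h]
        have hG' := hG r s₁ r s₂
        calc ‖α r s₁‖ * ‖α r s₂‖ * ‖(J((d : ℤ) | r * r) : ℂ)‖ * ‖G r s₁ r s₂‖
            ≤ ‖α r s₁‖ * ‖α r s₂‖ * 1 * 1 := by gcongr
          _ = ‖α r s₁‖ * ‖α r s₂‖ := by ring
      · -- `(d, r) > 1` (else `d ∣ s₂ - s₁`), so the symbol vanishes
        have hJ : J((d : ℤ) | r * r) = 0 := by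
          rw [jacobiSym.eq_zero_iff]
          refine ⟨mul_ne_zero hr0 hr0, fun hg => h2 ?_⟩
          rw [Int.gcd_natCast_natCast] at hg
          have hdr : Nat.Coprime d r := Nat.Coprime.coprime_dvd_right ⟨r, rfl⟩ hg
          have h3 : (d : ℤ) ∣ (r : ℤ) * ((s₂ : ℤ) - s₁) := by
            have he : (r : ℤ) * ((s₂ : ℤ) - s₁) = (r : ℤ) * s₂ - (r : ℤ) * s₁ := by ring
            rwa [he]
          exact Int.dvd_of_dvd_mul_right_of_gcd_one h3
            (by rw [Int.gcd_natCast_natCast]; exact hdr)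
        rw [if_neg h2, hJ, Int.cast_zero, mul_zero, zero_mul, norm_zero]
    · rw [if_neg h1, norm_zero]
      split_ifs <;> positivity
  -- the count for one `(r, s₁)`: `s₂ = s₁` gives `#𝒟`, `s₂ ≠ s₁` gives `τ(|s₂ − s₁|)`
  have hcount : ∀ r ∈ IR, ∀ s₁ ∈ IS,
      ∑ d ∈ 𝒟, ∑ s₂ ∈ IS, (if (d : ℤ) ∣ (s₂ : ℤ) - s₁ then ‖α r s₁‖ * ‖α r s₂‖ else 0) ≤
        #𝒟 * ‖α r s₁‖ ^ 2 + ∑ s₂ ∈ IS, (if s₂ ≠ s₁ then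
          (#(((s₂ : ℤ) - s₁).natAbs.divisors) : ℝ) * (‖α r s₁‖ * ‖α r s₂‖) else 0) := by
    intro r _ s₁ hs₁
    rw [sum_comm, ← sum_filter_add_sum_filter_not IS (fun s₂ => s₂ = s₁), filter_eq', if_pos hs₁,
      sum_singleton]
    refine add_le_add ?_ ?_
    · -- `s₂ = s₁`
      calc ∑ d ∈ 𝒟, (if (d : ℤ) ∣ (s₁ : ℤ) - s₁ then ‖α r s₁‖ * ‖α r s₁‖ else 0)
          ≤ ∑ d ∈ 𝒟, ‖α r s₁‖ * ‖α r s₁‖ := by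
            refine sum_le_sum fun d _ => ?_
            split_ifs
            · exact le_rfl
            · positivity
        _ = #𝒟 * ‖α r s₁‖ ^ 2 := by rw [sum_const, nsmul_eq_mul, sq]
    · -- `s₂ ≠ s₁`
      rw [sum_filter]
      refine sum_le_sum fun s₂ _ => ?_
      by_cases hne : s₂ = s₁
      · rw [if_neg (not_not.mpr hne), if_neg (not_not.mpr hne)]
      · rw [if_pos hne, if_pos hne, ← sum_filter, sum_const, nsmul_eq_mul]
        have hne' : (s₂ : ℤ) - s₁ ≠ 0 := by omega
        refine mul_le_mul_of_nonneg_right ?_ (by positivity)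
        exact_mod_cast card_filter_dvd_le_card_divisors_natAbs 𝒟 hne'
  -- the divisor sums against `‖α‖²`, for one `r`
  have hr_bound : ∀ r ∈ IR, ∑ s₁ ∈ IS, ∑ s₂ ∈ IS, (if s₂ ≠ s₁ then
      (#(((s₂ : ℤ) - s₁).natAbs.divisors) : ℝ) * (‖α r s₁‖ * ‖α r s₂‖) else 0) ≤
      2 * (S * (1 + Real.log S)) * ∑ s ∈ IS, ‖α r s‖ ^ 2 := by
    intro r _
    -- `ab ≤ (a² + b²)/2`
    have h1 : ∑ s₁ ∈ IS, ∑ s₂ ∈ IS, (if s₂ ≠ s₁ then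
        (#(((s₂ : ℤ) - s₁).natAbs.divisors) : ℝ) * (‖α r s₁‖ * ‖α r s₂‖) else 0) ≤
        ∑ s₁ ∈ IS, ∑ s₂ ∈ IS, (if s₂ ≠ s₁ then
          (#(((s₂ : ℤ) - s₁).natAbs.divisors) : ℝ) else 0) * (‖α r s₁‖ ^ 2 / 2) +
        ∑ s₁ ∈ IS, ∑ s₂ ∈ IS, (if s₂ ≠ s₁ then
          (#(((s₂ : ℤ) - s₁).natAbs.divisors) : ℝ) else 0) * (‖α r s₂‖ ^ 2 / 2) := by
      rw [← sum_add_distrib]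
      refine sum_le_sum fun s₁ _ => ?_
      rw [← sum_add_distrib]
      refine sum_le_sum fun s₂ _ => ?_
      split_ifs
      · have h0 : (0 : ℝ) ≤ #(((s₂ : ℤ) - s₁).natAbs.divisors) := Nat.cast_nonneg _
        nlinarith [two_mul_le_add_sq ‖α r s₁‖ ‖α r s₂‖]
      · simp
    -- the inner divisor sums
    have hT : ∀ s₁ ∈ IS, ∑ s₂ ∈ IS, (if s₂ ≠ s₁ then
        (#(((s₂ : ℤ) - s₁).natAbs.divisors) : ℝ) else 0) ≤ 2 * (S * (1 + Real.log S)) := by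
      intro s₁ hs₁
      rw [← sum_filter]
      exact sum_card_divisors_sub_le hs₁
    have hT' : ∀ s₂ ∈ IS, ∑ s₁ ∈ IS, (if s₂ ≠ s₁ then
        (#(((s₂ : ℤ) - s₁).natAbs.divisors) : ℝ) else 0) ≤ 2 * (S * (1 + Real.log S)) := by
      intro s₂ hs₂
      have e : ∑ s₁ ∈ IS, (if s₂ ≠ s₁ then (#(((s₂ : ℤ) - s₁).natAbs.divisors) : ℝ) else 0) =
          ∑ s₁ ∈ IS, (if s₁ ≠ s₂ then (#(((s₁ : ℤ) - s₂).natAbs.divisors) : ℝ) else 0) := by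
        refine sum_congr rfl fun s₁ _ => ?_
        rw [show ((s₂ : ℤ) - s₁) = -((s₁ : ℤ) - s₂) by ring, Int.natAbs_neg]
        simp only [ne_comm]
      rw [e, ← sum_filter]
      exact sum_card_divisors_sub_le hs₂
    have h2 : ∑ s₁ ∈ IS, ∑ s₂ ∈ IS, (if s₂ ≠ s₁ then
        (#(((s₂ : ℤ) - s₁).natAbs.divisors) : ℝ) else 0) * (‖α r s₁‖ ^ 2 / 2) ≤
        ∑ s₁ ∈ IS, 2 * (S * (1 + Real.log S)) * (‖α r s₁‖ ^ 2 / 2) := by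
      refine sum_le_sum fun s₁ hs₁ => ?_
      rw [← sum_mul]
      exact mul_le_mul_of_nonneg_right (hT s₁ hs₁) (by positivity)
    have h3 : ∑ s₁ ∈ IS, ∑ s₂ ∈ IS, (if s₂ ≠ s₁ then
        (#(((s₂ : ℤ) - s₁).natAbs.divisors) : ℝ) else 0) * (‖α r s₂‖ ^ 2 / 2) ≤
        ∑ s₂ ∈ IS, 2 * (S * (1 + Real.log S)) * (‖α r s₂‖ ^ 2 / 2) := by
      rw [sum_comm]
      refine sum_le_sum fun s₂ hs₂ => ?_
      rw [← sum_mul]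
      exact mul_le_mul_of_nonneg_right (hT' s₂ hs₂) (by positivity)
    have h4 : ∑ s₁ ∈ IS, 2 * (S * (1 + Real.log S)) * (‖α r s₁‖ ^ 2 / 2) =
        S * (1 + Real.log S) * ∑ s ∈ IS, ‖α r s‖ ^ 2 := by
      rw [mul_sum]
      refine sum_congr rfl fun s _ => ?_
      ring
    rw [h4] at h2 h3
    linarith
  -- assemble
  have hnn : 0 ≤ N2 := by rw [hN2]; positivity
  calc ‖∑ d ∈ Ioc 0 N, (F ((d : ℝ) / D) : ℂ) * ∑ r₁ ∈ IR, ∑ s₁ ∈ IS, ∑ r₂ ∈ IR, ∑ s₂ ∈ IS,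
        (if r₁ = r₂ ∧ (d : ℤ) ∣ (r₁ : ℤ) * s₂ - (r₂ : ℤ) * s₁ then
          α r₁ s₁ * conj (α r₂ s₂) * (J((d : ℤ) | r₁ * r₂) : ℂ) * G r₁ s₁ r₂ s₂ else 0)‖
      ≤ ∑ d ∈ Ioc 0 N, ‖(F ((d : ℝ) / D) : ℂ) * ∑ r₁ ∈ IR, ∑ s₁ ∈ IS, ∑ r₂ ∈ IR, ∑ s₂ ∈ IS,
        (if r₁ = r₂ ∧ (d : ℤ) ∣ (r₁ : ℤ) * s₂ - (r₂ : ℤ) * s₁ then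
          α r₁ s₁ * conj (α r₂ s₂) * (J((d : ℤ) | r₁ * r₂) : ℂ) * G r₁ s₁ r₂ s₂ else 0)‖ :=
        norm_sum_le _ _
    _ = ∑ d ∈ 𝒟, ‖(F ((d : ℝ) / D) : ℂ) * ∑ r₁ ∈ IR, ∑ s₁ ∈ IS, ∑ r₂ ∈ IR, ∑ s₂ ∈ IS,
        (if r₁ = r₂ ∧ (d : ℤ) ∣ (r₁ : ℤ) * s₂ - (r₂ : ℤ) * s₁ then
          α r₁ s₁ * conj (α r₂ s₂) * (J((d : ℤ) | r₁ * r₂) : ℂ) * G r₁ s₁ r₂ s₂ else 0)‖ := by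
        rw [h𝒟def, sum_filter_of_ne]
        intro d _ hne hF
        apply hne
        rw [hF, Complex.ofReal_zero, zero_mul, norm_zero]
    _ ≤ ∑ d ∈ 𝒟, ∑ r ∈ IR, ∑ s₁ ∈ IS, ∑ s₂ ∈ IS,
        (if (d : ℤ) ∣ (s₂ : ℤ) - s₁ then ‖α r s₁‖ * ‖α r s₂‖ else 0) := by
        refine sum_le_sum fun d hd => ?_
        rw [norm_mul, Complex.norm_real, Real.norm_eq_abs, abs_of_nonneg (hF0 _), hdiag d]
        refine (mul_le_of_le_one_left (norm_nonneg _) (hF1 _)).trans ?_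
        refine (norm_sum_le _ _).trans (sum_le_sum fun r hr => ?_)
        refine (norm_sum_le _ _).trans (sum_le_sum fun s₁ hs₁ => ?_)
        refine (norm_sum_le _ _).trans (sum_le_sum fun s₂ hs₂ => ?_)
        exact hterm d hd r hr s₁ hs₁ s₂ hs₂
    _ = ∑ r ∈ IR, ∑ s₁ ∈ IS, ∑ d ∈ 𝒟, ∑ s₂ ∈ IS,
        (if (d : ℤ) ∣ (s₂ : ℤ) - s₁ then ‖α r s₁‖ * ‖α r s₂‖ else 0) := by
        rw [sum_comm]
        refine sum_congr rfl fun r _ => ?_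
        rw [sum_comm]
    _ ≤ ∑ r ∈ IR, ∑ s₁ ∈ IS, (#𝒟 * ‖α r s₁‖ ^ 2 + ∑ s₂ ∈ IS, (if s₂ ≠ s₁ then
          (#(((s₂ : ℤ) - s₁).natAbs.divisors) : ℝ) * (‖α r s₁‖ * ‖α r s₂‖) else 0)) :=
        sum_le_sum fun r hr => sum_le_sum fun s₁ hs₁ => hcount r hr s₁ hs₁
    _ = #𝒟 * N2 + ∑ r ∈ IR, ∑ s₁ ∈ IS, ∑ s₂ ∈ IS, (if s₂ ≠ s₁ then
          (#(((s₂ : ℤ) - s₁).natAbs.divisors) : ℝ) * (‖α r s₁‖ * ‖α r s₂‖) else 0) := by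
        rw [hN2, mul_sum]
        simp only [sum_add_distrib, mul_sum]
    _ ≤ #𝒟 * N2 + ∑ r ∈ IR, 2 * (S * (1 + Real.log S)) * ∑ s ∈ IS, ‖α r s‖ ^ 2 := by
        gcongr with r hr
        exact hr_bound r hr
    _ = (#𝒟 + 2 * (S * (1 + Real.log S))) * N2 := by
        rw [hN2, ← mul_sum]
        ring
    _ ≤ (3 * D + 2 * (S * (1 + Real.log S))) * N2 := by
        gcongr

end Literature.NumberTheory.Sieve.FriedlanderIwaniecPrimes
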